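import Summits.QuantumFields.QCD.Theorems.PauliWegnerSeaFMClosureUnquenchedDefs

/-!
# Crux `FrameFMClosure` (stmt-QuantumFields-17375) — ideator 1, round 1: first lemmas of card `pad-the-fibre`

Vocabulary of the sibling crux (`Theorems/PauliWegnerSeaFMClosureUnquenchedDefs.lean`, namespace
`…Theorems.VonMisesCircles`): `ebox`, `sideMatrix`, `wilsonD`, `blockNorm`, `AdmissibleSide`, `FibreBandLaw`,
`SideWitness`, `TwoStarBounds`, `LocalCofactorDomination`.

The card replaces the two-star refit region of K1♭ (`LocalCofactorDomination`: the ≤ 16 links at `x, y`; hostage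
to REALISABLE semi-dark port data, `Cruxes/FibreCofactorDomination/DarkLeafTaxonomy.md` §§2,5,7) by a PADDED
region: the two stars plus one EVEN `4⁴` pad (`ebox · 1`, 256 sites, 768 links, bipartite-balanced 128/128)
holding each of `x, y` in its inner `2⁴` core (16 positions per point, so the bootstrap can still slide the pad).
For such regions the fixed-spinor/tree-gauge construction of abstract semi-dark points (DarkLeafTaxonomy §7) has,
by direct rank computation with the stars forced into the spanning tree (kit j025258), NO kernel section visible at
`x` (≤ 1e-14 at every probe mass incl. the doubler a = 0), while thin regions (2⁴ cell, 4³×1, 4³×2) and corner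
positions do; so the domination inequality is a candidate for an ABSTRACT (exterior-free, hence volume-free) theorem
about one finite-dimensional matrix pencil.
-/

noncomputable section

namespace Summit.QuantumFields.QCD.Cruxes.FrameFMClosure.PadTheFibre

open scoped BigOperators
open MeasureTheory Filter
open Literature.MathematicalPhysics.QuantumFieldTheory Literature.MathematicalPhysics.QuantumLattice
  Literature.Probability.LatticeModels
open Summit.QuantumFields.QCD.Theorems.VonMisesCircles

local notation "𝔾" => Matrix.specialUnitaryGroup (Fin 3) ℂ

open Classical in
/-- The links of the even pad about `x'`: both endpoints in `ebox S x' 1 = x' + {-2,-1,0,1}⁴` (768 links). -/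
def padLinks (S : ℕ) (x' : TorusSite 4 (2 * S + 1)) : Finset (Edge 4 (2 * S + 1)) :=
  Finset.univ.filter fun e => e.1 ∈ ebox S x' 1 ∧ e.1.shift e.2 ∈ ebox S x' 1

open Classical in
/-- The star of `x`: the ≤ 8 links with an endpoint at `x` (K1♭'s refit links at one site). -/
def starLinks (S : ℕ) (x : TorusSite 4 (2 * S + 1)) : Finset (Edge 4 (2 * S + 1)) :=
  Finset.univ.filter fun e => e.1 = x ∨ e.1.shift e.2 = x

open Classical in
/-- A boundary layer of the pad about `x'`: the sites with offset coordinate `μ` equal to `c` (`c = -2` or `c = 1`). -/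
def padLayer (S : ℕ) (x' : TorusSite 4 (2 * S + 1)) (μ : Fin 4) (c : ℤ) : Finset (TorusSite 4 (2 * S + 1)) :=
  ((Fintype.piFinset fun _ : Fin 4 => Finset.Icc (-2 : ℤ) 1).filter fun w => w μ = c).image
    fun w => x' + Torus.proj (2 * S + 1) w

open Classical in
/-- The pad links MINUS the in-layer links of one boundary layer: the region the bootstrap can afford next to a frozen
zone (in clause (T1) the layer of the pad that lies inside `W`, whose in-layer links must stay frozen so that the
inside factor is constant on the fibre; the rungs out of the layer are kept). -/
def padLinksBut (S : ℕ) (x' : TorusSite 4 (2 * S + 1)) (μ : Fin 4) (c : ℤ) : Finset (Edge 4 (2 * S + 1)) :=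
  (padLinks S x').filter fun e => ¬ (e.1 ∈ padLayer S x' μ c ∧ e.1.shift e.2 ∈ padLayer S x' μ c)

/-- **Padded cofactor domination** (the card's replacement for K1♭): ONE constant `C₀` such that for every probe
mass `m₀ ∈ [-9, 1]`, every odd torus, background `U`, admissible side `A`, sites `x, y ∈ A`, every choice of even
pads `ebox S x' 1`, `ebox S y' 1` holding `x` resp. `y` in their inner `2⁴` CORE (`x ∈ ebox S x' 0 = x' + {-1,0}⁴`: all
eight neighbours of `x` inside the pad — corner, edge and face positions admit visible ansatz kernels, kit
j025258/j025267), every choice of ONE boundary layer per pad whose in-layer links may stay frozen (the (T1) collar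
geometry) and EVERY refit region `R` containing the two stars and the two pads-minus-a-layer (a fortiori the full
pads, by monotonicity):
along the `R`-fibre over `U`, the `(x,y)` adjugate block of the side matrix is dominated by `C₀ ·` the fibre
supremum of `|det|`.  Monotone in `R` by construction; K1♭ is the same text with `R ⊇ stars` only, so K1♭
implies it (freeze the pads into the exterior). -/
def PaddedCofactorDomination : Prop :=
  ∃ C₀ : ℝ, 0 < C₀ ∧ ∀ (m₀ : ℝ), -9 ≤ m₀ → m₀ ≤ 1 →
    ∀ (S : ℕ) (U : GaugeConfig 4 (2 * S + 1) 𝔾) (A : Finset (TorusSite 4 (2 * S + 1))),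
      AdmissibleSide S A → ∀ (x y : TorusSite 4 (2 * S + 1)), x ∈ A → y ∈ A →
      ∀ (x' y' : TorusSite 4 (2 * S + 1)), x ∈ ebox S x' 0 → y ∈ ebox S y' 0 →
      ∀ (μ ν : Fin 4) (c d : ℤ), (c = -2 ∨ c = 1) → (d = -2 ∨ d = 1) →
      ∀ (R : Finset (Edge 4 (2 * S + 1))),
        starLinks S x ∪ starLinks S y ∪ padLinksBut S x' μ c ∪ padLinksBut S y' ν d ⊆ R →
        ∀ W : GaugeConfig 4 (2 * S + 1) 𝔾, ∃ W' : GaugeConfig 4 (2 * S + 1) 𝔾,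
          blockNorm ((sideMatrix A (wilsonD (fun e => if e ∈ R then W e else U e) m₀)).adjugate) x y ≤
            C₀ * ‖(sideMatrix A (wilsonD (fun e => if e ∈ R then W' e else U e) m₀)).det‖

/-- K1♭ implies the padded statement (two-star domination is uniform in the exterior, so freezing the pad links
into the exterior gives it): the padded statement is the WEAKER deterministic input.  PROVED here (no sorry):
the first sanity check of the line. -/
theorem padded_of_localCofactorDomination :
    LocalCofactorDomination → PaddedCofactorDomination := by
  rintro ⟨C₀, hC₀, h⟩
  refine ⟨C₀, hC₀, ?_⟩
  intro m₀ hm₁ hm₂ S U A hA x y hx hy x' y' _ _ μ ν c d _ _ R hR W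
  -- every star link lies in the region
  have hstar : ∀ e : Edge 4 (2 * S + 1),
      (e.1 = x ∨ e.1.shift e.2 = x ∨ e.1 = y ∨ e.1.shift e.2 = y) → e ∈ R := by
    intro e he
    apply hR
    simp only [Finset.mem_union, starLinks, Finset.mem_filter, Finset.mem_univ, true_and]
    rcases he with h1 | h2 | h3 | h4
    · exact Or.inl (Or.inl (Or.inl (Or.inl h1)))
    · exact Or.inl (Or.inl (Or.inl (Or.inr h2)))
    · exact Or.inl (Or.inl (Or.inr (Or.inl h3)))
    · exact Or.inl (Or.inl (Or.inr (Or.inr h4)))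
  -- freeze the whole refit region into the background and apply two-star domination there
  have key := h m₀ hm₁ hm₂ S (fun e => if e ∈ R then W e else U e) A hA x y hx hy
  simp only at key
  obtain ⟨W'', hW''⟩ := key W
  have e1 : (fun e => if e ∈ R then W e else U e) =
      (fun e => if (e.1 = x ∨ e.1.shift e.2 = x ∨ e.1 = y ∨ e.1.shift e.2 = y) then W e
        else (if e ∈ R then W e else U e)) := by
    funext e
    by_cases hs : (e.1 = x ∨ e.1.shift e.2 = x ∨ e.1 = y ∨ e.1.shift e.2 = y)
    · simp only [hs, if_true, hstar e hs]
    · simp only [hs, if_false]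
  have e2 : (fun e => if e ∈ R then
        (if (e.1 = x ∨ e.1.shift e.2 = x ∨ e.1 = y ∨ e.1.shift e.2 = y) then W'' e else W e) else U e) =
      (fun e => if (e.1 = x ∨ e.1.shift e.2 = x ∨ e.1 = y ∨ e.1.shift e.2 = y) then W'' e
        else (if e ∈ R then W e else U e)) := by
    funext e
    by_cases hs : (e.1 = x ∨ e.1.shift e.2 = x ∨ e.1 = y ∨ e.1.shift e.2 = y)
    · simp only [hs, if_true, hstar e hs]
    · simp only [hs, if_false]
  refine ⟨fun e => if (e.1 = x ∨ e.1.shift e.2 = x ∨ e.1 = y ∨ e.1.shift e.2 = y) then W'' e else W e, ?_⟩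
  dsimp only
  rw [e1, e2]
  exact hW''

/-- **First lemma of the line (reduction, size M–L: a re-run of the landed `VonMisesCirclesC1.stub_twoStar` with
padded fibres chosen clause by clause — pads inside the side `A` for (Tdec), inside the collar for (T1)):** the fibre
band law (landed, `fibreBandLaw_holds`, used at `n = 2·768 + 16` links and degree `4 N_f + 4`), padded cofactor
domination and the side witnesses (landed, `c1_sideWitness`) give the averaged two-star package consumed by the
landed closures `closure_from_two` / `coreOutward_of_twoStarBounds_farStability` (p141195 / p149039). -/
theorem twoStarBounds_of_padded :
    FibreBandLaw → PaddedCofactorDomination → SideWitness → ∀ Nf : ℕ, TwoStarBounds Nf := by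
  sorry

end Summit.QuantumFields.QCD.Cruxes.FrameFMClosure.PadTheFibre
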